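import Summits.Ventures.CertifiedManyBodySolver.Observables.StiffnessApexTransport
import HarnessLib

/-!
# Ventures/CertifiedManyBodySolver — Observables/StiffnessApexTransportAnyDensity.lean

HONEST FRAMING: one-sided certified CEILINGS on the uniform flux stiffness (t–t′ f-sum class) at ANY density, TRANSPORTED along apex
curves of the `(t′, U)` plane; conditional on the source rows they name; a ceiling never speaks to the presence of order; not a `T_c`
estimate, not a superconductivity verdict. Zero compute, no definition, no claim node, no `sorry`.

Cell `pub/hubbard-downfold` (D-0150 L-DF2 «box ↦ one word»), seat `hubbard-downfold-unc-2` (`prover-hubbard-downfold-unc-2-g13-0`). The DOPED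
boxes of the validation set (every cuprate box except the parents) cannot use the half-filling sign `t′K₂ ≤ 0` of
`Observables/StiffnessApexTransport.lean` §3; what replaces it is CONVEXITY IN THE HOPPING SLOT for one and the same source state: the
target's apex hopping `2t′_P = 2sU/(2U − U_A)` lies between the source hopping `s` and its double `2s` (`2t′_P = (1 − μ)s + μ·2s`,
`μ = U_A/(2U − U_A) ∈ [0, 1)`), and `κ ↦ e_{Φ(1,κ,0)}(ω) = K₁(ω) + κK₂(ω)` is AFFINE, so two one-body floors on the SOURCE class — at the
source's own f-sum hopping `2s` (its `kinx` word) and at the source hopping `s` itself (its total kinetic / `kin` word, `e_{Φ(1,s,0)} = K₁ + sK₂`)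
— bound `e_{Φ(1,2t′_P,0)}` on the source class from below by `min(ℓ₁, ℓ₂)`, whence (apex row) on the target class, whence the leaf:

* `oneBody_ge_min_of_two_hoppings` — the affine interpolation, every state;
* `ObsStiffnessSeqCeilingAt_on_apexCurve_of_forall_source_kinetic_and_fsum_ge` — ANY density `0 ≤ n < 2`: floors `ℓ₁ ≤ e_{Φ(1,s,0)}`,
  `ℓ₂ ≤ e_{Φ(1,2s,0)}` on the torus-limit ground-state class at `(s, U_A, n)` ⇒ `ObsStiffnessSeqCeilingAt (sU/(2U − U_A)) U n c` for every
  `U > U_A` and every `c ≥ max(−ℓ₁, −ℓ₂)/4` — the word along the apex curve is the worse of the source's f-sum word and a quarter of its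
  total-kinetic word (at half filling the f-sum word alone, `…_halfFilling_on_apexCurve_of_fsumRow`);
* `ObsStiffnessSeqCeilingAt_on_apexCurve_of_fsumRow_and_kinetic_ge` — the same with the f-sum input in the cell's orbit-row shape
  (`SquareTTPrimeCorrOrbitLowerRow s U_A n u r univ Λ₇ (−X₀(s))` + cap) and the total-kinetic input as a one-body floor.
Worked reading (no new row; numbers of record BY NAME, not restated as theorems here): at A0 = `(8, 7/8, −1/4)` the f-sum word is `0.3603604`
(registry row 22) and the derived total-hopping floor is `−1.6032982` (`m3_tpm1o4_hoppingDensity_ge_derived`, #448 ∧ #257), so along A0's apex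
curve `t′ = −U/(8U − 32)` (`(10, −5/24)`, `(12, −3/16)`, `(16, −1/6)`) the f-sum leaf reads `≤ max(0.3603604, 0.4008246) = 0.4008246` — at the
kinematic scale, i.e. CONTENT-FREE today: doped apex words need a certified total-kinetic (or `K₂`-sign) row sharper than the program-free one.

References: T. Koma, H. Tasaki, J. Stat. Phys. 76 (1994) 745, §1 [KomaTasaki1994]; D. J. Scalapino, S. R. White, S.-C. Zhang, PRB 47 (1993)
7995, §II [ScalapinoWhiteZhang1993].
-/

noncomputable section

namespace Summit.Ventures.CertifiedManyBodySolver.Observables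

open Literature.MathematicalPhysics.QuantumLattice
open Literature.MathematicalPhysics.QuantumLattice.ThermodynamicLimit
open Literature.MathematicalPhysics.QuantumFieldTheory
open Literature.Probability.LatticeModels
open Matrix Finset Filter Topology HubbardWave0
open scoped Matrix BigOperators ComplexOrder

/-- **Affine interpolation in the hopping slot, every state.** `0 ≤ μ ≤ 1`, `κ = (1 − μ)·s + μ·(2s)`: floors `ℓ₁ ≤ e_{Φ(1,s,0)}(ω)` and
`ℓ₂ ≤ e_{Φ(1,2s,0)}(ω)` give `min(ℓ₁, ℓ₂) ≤ e_{Φ(1,κ,0)}(ω)` (`e_{Φ(1,κ,0)} = K₁ + κK₂` is affine in `κ`, `meanEnergy_hubbardTTPrime_eq_coords`). [folklore] -/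
theorem oneBody_ge_min_of_two_hoppings (ω : InfVolFermionState 2) {s μ κ ℓ₁ ℓ₂ : ℝ} (hμ0 : 0 ≤ μ) (hμ1 : μ ≤ 1)
    (hκ : κ = (1 - μ) * s + μ * (2 * s)) (h₁ : ℓ₁ ≤ ω.meanEnergy (hubbardTTPrimeFermionInteraction 1 s 0) 1)
    (h₂ : ℓ₂ ≤ ω.meanEnergy (hubbardTTPrimeFermionInteraction 1 (2 * s) 0) 1) :
    min ℓ₁ ℓ₂ ≤ ω.meanEnergy (hubbardTTPrimeFermionInteraction 1 κ 0) 1 := by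
  rw [ω.meanEnergy_hubbardTTPrime_eq_coords 1 s 0] at h₁
  rw [ω.meanEnergy_hubbardTTPrime_eq_coords 1 (2 * s) 0] at h₂
  rw [ω.meanEnergy_hubbardTTPrime_eq_coords 1 κ 0, hκ]
  have hm₁ : min ℓ₁ ℓ₂ ≤ ℓ₁ := min_le_left _ _
  have hm₂ : min ℓ₁ ℓ₂ ≤ ℓ₂ := min_le_right _ _
  have p₁ := mul_le_mul_of_nonneg_left (hm₁.trans h₁) (sub_nonneg.2 hμ1)
  have p₂ := mul_le_mul_of_nonneg_left (hm₂.trans h₂) hμ0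
  nlinarith [p₁, p₂]

section Curve

variable {s UA n : ℝ}

/-- **ANY DENSITY: the apex curve of a source from its f-sum AND total-kinetic floors.** `U_A ≥ 0`, `0 ≤ n < 2`. If on the torus-limit
ground-state class at `(s, U_A, n)` the one-body energies at the source hopping and at its double are bounded below —
`ℓ₁ ≤ e_{Φ(1,s,0)}(ω)` (minus the total kinetic magnitude, the `kin` word) and `ℓ₂ ≤ e_{Φ(1,2s,0)}(ω)` (minus four times the f-sum word) — then
`ObsStiffnessSeqCeilingAt (s·U/(2U − U_A)) U n c` for EVERY `U > U_A` and every `c ≥ max(−ℓ₁, −ℓ₂)/4`: along the apex curve the target hopping's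
double `2sU/(2U − U_A)` is the convex combination `(1 − μ)s + μ(2s)`, `μ = U_A/(2U − U_A)`, so `oneBody_ge_min_of_two_hoppings` feeds
`ObsStiffnessSeqCeilingAt_of_forall_apexSource_oneBody_ge`. [cite: KomaTasaki1994, §1] [cite: ScalapinoWhiteZhang1993, §II] -/
theorem ObsStiffnessSeqCeilingAt_on_apexCurve_of_forall_source_kinetic_and_fsum_ge (hUA : 0 ≤ UA) (hn0 : 0 ≤ n) (hn2 : n < 2)
    {ℓ₁ ℓ₂ : ℝ}
    (h₁ : ∀ (ω : InfVolFermionState 2) (Ls : ℕ → ℕ) (ψ : ∀ L, Fock (Orb (FermionTorus 2 L))),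
      Tendsto Ls atTop atTop →
      (∀ j, IsGroundStateInSector (hubbardTorusTT' (Ls j) 1 s UA) (rectN n (Ls j)) 0 (ψ (Ls j))) →
      (∀ j, star (ψ (Ls j)) ⬝ᵥ ψ (Ls j) = 1) → ω.IsTorusLimitOf ψ Ls →
      ℓ₁ ≤ ω.meanEnergy (hubbardTTPrimeFermionInteraction 1 s 0) 1)
    (h₂ : ∀ (ω : InfVolFermionState 2) (Ls : ℕ → ℕ) (ψ : ∀ L, Fock (Orb (FermionTorus 2 L))),
      Tendsto Ls atTop atTop →
      (∀ j, IsGroundStateInSector (hubbardTorusTT' (Ls j) 1 s UA) (rectN n (Ls j)) 0 (ψ (Ls j))) →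
      (∀ j, star (ψ (Ls j)) ⬝ᵥ ψ (Ls j) = 1) → ω.IsTorusLimitOf ψ Ls →
      ℓ₂ ≤ ω.meanEnergy (hubbardTTPrimeFermionInteraction 1 (2 * s) 0) 1)
    (c : ℚ) (hc₁ : -ℓ₁ / 4 ≤ ((c : ℚ) : ℝ)) (hc₂ : -ℓ₂ / 4 ≤ ((c : ℚ) : ℝ)) {U : ℝ} (hU : UA < U) :
    ObsStiffnessSeqCeilingAt (s * U / (2 * U - UA)) U n c := by
  have h2 : 0 < 2 * U - UA := by linarith
  have hapex : U * s = (2 * U - UA) * (s * U / (2 * U - UA)) := by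
    have e : (2 * U - UA) * (s * U / (2 * U - UA)) = s * U := by field_simp
    rw [e, mul_comm]
  have hμ0 : 0 ≤ UA / (2 * U - UA) := div_nonneg hUA h2.le
  have hμ1 : UA / (2 * U - UA) ≤ 1 := (div_le_one h2).2 (by linarith)
  have hκ : 2 * (s * U / (2 * U - UA)) = (1 - UA / (2 * U - UA)) * s + UA / (2 * U - UA) * (2 * s) := by
    field_simp
    ring
  have hmin : -min ℓ₁ ℓ₂ / 4 ≤ ((c : ℚ) : ℝ) := by
    rcases le_total ℓ₁ ℓ₂ with h | h
    · rw [min_eq_left h]; exact hc₁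
    · rw [min_eq_right h]; exact hc₂
  exact ObsStiffnessSeqCeilingAt_of_forall_apexSource_oneBody_ge hUA hU hapex hn0 hn2 (ℓ := min ℓ₁ ℓ₂)
    (fun ω Ls ψ hLs hψ h1 hω => oneBody_ge_min_of_two_hoppings ω hμ0 hμ1 hκ (h₁ ω Ls ψ hLs hψ h1 hω)
      (h₂ ω Ls ψ hLs hψ h1 hω)) c hmin

/-- **The same with the f-sum input in orbit-row shape.** Source class `(s, U_A, n)`: a certified f-sum orbit row
`SquareTTPrimeCorrOrbitLowerRow s U_A n u r univ Λ₇ (−X₀(s))` (any `U`-slot `Uo` in the operator) with its cap `e₀ ≤ u` certified, and a one-body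
floor `ℓ₁ ≤ e_{Φ(1,s,0)}(ω)` (total kinetic word) on the class ⇒ `ObsStiffnessSeqCeilingAt (s·U/(2U − U_A)) U n c` for every `U > U_A` and every
`c ≥ max(−r, −ℓ₁/4)`. [cite: KomaTasaki1994, §1] [cite: ScalapinoWhiteZhang1993, §II] -/
theorem ObsStiffnessSeqCeilingAt_on_apexCurve_of_fsumRow_and_kinetic_ge (Uo : ℝ) (hUA : 0 ≤ UA) (hn0 : 0 ≤ n)
    (hn2 : n < 2) {u r : ℚ} {ℓ₁ : ℝ}
    (hrow : SquareTTPrimeCorrOrbitLowerRow s UA n u r Finset.univ (box 2 7) (-oddMomentObsTT s Uo 0))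
    (hu : energyDensityTT' 1 s UA n ≤ ((u : ℚ) : ℝ))
    (h₁ : ∀ (ω : InfVolFermionState 2) (Ls : ℕ → ℕ) (ψ : ∀ L, Fock (Orb (FermionTorus 2 L))),
      Tendsto Ls atTop atTop →
      (∀ j, IsGroundStateInSector (hubbardTorusTT' (Ls j) 1 s UA) (rectN n (Ls j)) 0 (ψ (Ls j))) →
      (∀ j, star (ψ (Ls j)) ⬝ᵥ ψ (Ls j) = 1) → ω.IsTorusLimitOf ψ Ls →
      ℓ₁ ≤ ω.meanEnergy (hubbardTTPrimeFermionInteraction 1 s 0) 1)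
    (c : ℚ) (hcr : -r ≤ c) (hc₁ : -ℓ₁ / 4 ≤ ((c : ℚ) : ℝ)) {U : ℝ} (hU : UA < U) :
    ObsStiffnessSeqCeilingAt (s * U / (2 * U - UA)) U n c := by
  have hcr' : -((r : ℚ) : ℝ) ≤ ((c : ℚ) : ℝ) := by exact_mod_cast hcr
  refine ObsStiffnessSeqCeilingAt_on_apexCurve_of_forall_source_kinetic_and_fsum_ge hUA hn0 hn2 h₁ (ℓ₂ := 4 * ((r : ℚ) : ℝ))
    (fun ω Ls ψ hLs hψ h1 hω => ?_) c hc₁ (by linarith) hU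
  have h := hrow ω Ls ψ hLs hψ h1 hω hu
  rw [orbitMean_re_expect_neg_oddMomentTT_lam_zero hω.isTranslationInvariant] at h
  linarith

/-- A0's apex curve points and the two numbers quoted in the header (pure arithmetic): `(−1/4)·10/(20 − 8) = −5/24`,
`(−1/4)·12/(24 − 8) = −3/16`, `(−1/4)·16/(32 − 8) = −1/6`; `1.6032981603/4 < 0.4008246`. [folklore] -/
theorem a0_apexCurve_points_and_kinetic_quarter :
    (-1 / 4 : ℝ) * 10 / (2 * 10 - 8) = -5 / 24 ∧ (-1 / 4 : ℝ) * 12 / (2 * 12 - 8) = -3 / 16 ∧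
      (-1 / 4 : ℝ) * 16 / (2 * 16 - 8) = -1 / 6 ∧ (1.6032981603 : ℝ) / 4 < 0.4008246 := by
  refine ⟨?_, ?_, ?_, ?_⟩ <;> norm_num

end Curve

end Summit.Ventures.CertifiedManyBodySolver.Observables

end
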